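import Summits.ValiantsHypothesis.ValiantsHypothesis.Theorems.KPlusLogSqLawTridiagonalRealStaticUnitDominantRules
import Summits.ValiantsHypothesis.ValiantsHypothesis.Theorems.KPlusLogSqLawTridiagonalRealStaticUnitLeadingSign

/-!
# Route «KPlusLogSqLaw», crux `WeakLifting` (stmt-ValiantsHypothesis-19561) — REAL side of the tridiagonal sector:
# the UNIT-COEFFICIENT sub-sector — SIZE 7: the DOMINANT WORD at every zero above the resonance

HONEST FRAMING.  Helper theorems (`--supports stmt-ValiantsHypothesis-19561 --as helper`), seat val-sym-lift-p1 (g19), cell `pub-symmetroid`,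
2026-08-28 (desk R2705 (A): «SIZE-7 DOMINANT WORD»); corollary file of `…UnitDominantRules` (p642083).  Continuants
`D_k = pathDet (fun _ => 1) d (fun _ => 1) f k` of a unit design with ALL EDGE SLOPES POSITIVE (`d_k + d_{k+1} < 2f_k`).  Size `7` is the first size
whose dominant side is not rigid (sizes `3, 5`: no zero above `1`; sizes `4, 6, 8`: every zero above `1` is top class, p642083); what IS rigid at
size `7` is the SIGN WORD: at every zero `x > 1` of `D₇`
* `signs_above_one_seven` — `D₁ > 0, D₂ < 0, D₃ < 0, D₄ < 0, D₅ > 0, D₆ > 0` (pivot-product word `+ − + + − +`, continuant word `+ + − − − + +`):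
  the dominant dictionary `pivot_rules_of_dominant` with `n = 5` (`P₀, P₅ > 0`, `P₁, P₄ < 0`, negatives have positive neighbours) leaves no choice;
* `sturmCount_six_eq_two_of_root_seven` — hence the leading `6 × 6` block has EXACTLY TWO negative pivots at every zero of `D₇` above `1`: every
  dominant zero of a one-signed size-7 design sits on the inertia interface `2 | 3` (the count `#{k < 7 : D_kD_{k+1} < 0}` is `2` or `3` on either
  side), so consecutive zeros above `1` alternately raise and lower the inertia — the mechanism of the four-zero design of `…UnitSevenOneSignedFour`
  (p644354: up at `≈ 1.47`, down at `≈ 2.73`) and, with longer chains, of the size-9/11 witnesses (p651928, p652412).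
Located, not claimed: no bound on the NUMBER of zeros above `1` follows from the word alone (census maximum `2`).  Nothing here is an upper law for the
register (α NO MOVER); nothing bears on `WeakLifting` / `TropicalB` (stmt-19771) in their windows, Conjecture B, the Door-A registers, `MatrixDescartes`
(stmt-18050) or VP ≠ VNP.
[this seat; folklore: continuants, LDLᵀ pivots / Sturm counts of Jacobi matrices]
-/

-- `Summit.ValiantsHypothesis.ValiantsHypothesis.…` repeats a component by the D-0017 layout (single-conjunct summit); the name is mandated.
set_option linter.dupNamespace false
set_option autoImplicit false

namespace Summit.ValiantsHypothesis.ValiantsHypothesis.Theorems.KPlusLogSqLaw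
namespace StaticTridiagonalRealUnit

open Real Finset Polynomial
open Summit.ValiantsHypothesis.ValiantsHypothesis.Theorems.KPlusLogSqLaw.StaticTridiagonalRealPotential (pathDet)

variable (d : ℕ → ℕ) (f : ℕ → ℕ)

/-- **THE SIZE-7 DOMINANT WORD**: all edge slopes positive, `x > 1`, `D₇(x) = 0` ⇒ `D₁(x) > 0`, `D₂(x) < 0`, `D₃(x) < 0`, `D₄(x) < 0`, `D₅(x) > 0`,
`D₆(x) > 0`. [this file] -/
theorem signs_above_one_seven (x : ℝ) (hx1 : 1 < x) (hslope : ∀ k, k + 1 < 7 → d k + d (k + 1) < 2 * f k)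
    (hroot : (pathDet (fun _ => (1 : ℝ)) d (fun _ => (1 : ℝ)) f 7).eval x = 0) :
    0 < (pathDet (fun _ => (1 : ℝ)) d (fun _ => (1 : ℝ)) f 1).eval x ∧ (pathDet (fun _ => (1 : ℝ)) d (fun _ => (1 : ℝ)) f 2).eval x < 0 ∧
      (pathDet (fun _ => (1 : ℝ)) d (fun _ => (1 : ℝ)) f 3).eval x < 0 ∧ (pathDet (fun _ => (1 : ℝ)) d (fun _ => (1 : ℝ)) f 4).eval x < 0 ∧
      0 < (pathDet (fun _ => (1 : ℝ)) d (fun _ => (1 : ℝ)) f 5).eval x ∧ 0 < (pathDet (fun _ => (1 : ℝ)) d (fun _ => (1 : ℝ)) f 6).eval x := by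
  have hx : 0 < x := one_pos.trans hx1
  have hdom : ∀ k, k ≤ 5 → x ^ (d k + d (k + 1)) < x ^ (2 * f k) := fun k hk => pow_lt_pow_right₀ hx1 (hslope k (by omega))
  have hnd := nondegenerate_above_one_of_le_eight d f 7 (by norm_num) x hx1 hslope hroot
  obtain ⟨hP0, hP5, hP1, hP4, hnb, -⟩ := pivot_rules_of_dominant d f 5 x hx hdom hroot (fun k hk0 hk => hnd k hk0 (by omega))
  have hP1' := hP1 (by norm_num)
  have hP4' : (pathDet (fun _ => (1 : ℝ)) d (fun _ => (1 : ℝ)) f 4).eval x * (pathDet (fun _ => (1 : ℝ)) d (fun _ => (1 : ℝ)) f 5).eval x < 0 :=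
    hP4 (by norm_num)
  have hP2 : 0 < (pathDet (fun _ => (1 : ℝ)) d (fun _ => (1 : ℝ)) f 2).eval x * (pathDet (fun _ => (1 : ℝ)) d (fun _ => (1 : ℝ)) f 3).eval x :=
    ((hnb 1 (by norm_num)).1 hP1')
  have hP3 : 0 < (pathDet (fun _ => (1 : ℝ)) d (fun _ => (1 : ℝ)) f 3).eval x * (pathDet (fun _ => (1 : ℝ)) d (fun _ => (1 : ℝ)) f 4).eval x :=
    ((hnb 3 (by norm_num)).2 hP4')
  have hD0 : (pathDet (fun _ => (1 : ℝ)) d (fun _ => (1 : ℝ)) f 0).eval x = 1 := (eval_unit_zero_one d f x).1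
  rw [hD0, one_mul] at hP0
  have hD2 : (pathDet (fun _ => (1 : ℝ)) d (fun _ => (1 : ℝ)) f 2).eval x < 0 := by
    by_contra h; exact absurd hP1' (not_lt.2 (mul_nonneg hP0.le (not_lt.1 h)))
  have hD3 : (pathDet (fun _ => (1 : ℝ)) d (fun _ => (1 : ℝ)) f 3).eval x < 0 := by
    by_contra h; exact absurd hP2 (not_lt.2 (mul_nonpos_of_nonpos_of_nonneg hD2.le (not_lt.1 h)))
  have hD4 : (pathDet (fun _ => (1 : ℝ)) d (fun _ => (1 : ℝ)) f 4).eval x < 0 := by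
    by_contra h; exact absurd hP3 (not_lt.2 (mul_nonpos_of_nonpos_of_nonneg hD3.le (not_lt.1 h)))
  have hD5 : 0 < (pathDet (fun _ => (1 : ℝ)) d (fun _ => (1 : ℝ)) f 5).eval x := by
    by_contra h; exact absurd hP4' (not_lt.2 (mul_nonneg_of_nonpos_of_nonpos hD4.le (not_lt.1 h)))
  have hD6 : 0 < (pathDet (fun _ => (1 : ℝ)) d (fun _ => (1 : ℝ)) f 6).eval x := by
    by_contra h; exact absurd hP5 (not_lt.2 (mul_nonpos_of_nonneg_of_nonpos hD5.le (not_lt.1 h)))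
  exact ⟨hP0, hD2, hD3, hD4, hD5, hD6⟩

/-- **INERTIA AT A DOMINANT ZERO OF SIZE 7**: all edge slopes positive, `x > 1`, `D₇(x) = 0` ⇒ exactly TWO of the pivot products `D_kD_{k+1}`,
`k < 6`, are negative (namely `k = 1, 4`): the leading `6 × 6` block carries exactly two negative pivots, so the zero lies on the inertia interface
`2 | 3`. [this file] -/
theorem sturmCount_six_eq_two_of_root_seven (x : ℝ) (hx1 : 1 < x) (hslope : ∀ k, k + 1 < 7 → d k + d (k + 1) < 2 * f k)
    (hroot : (pathDet (fun _ => (1 : ℝ)) d (fun _ => (1 : ℝ)) f 7).eval x = 0) :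
    (Finset.univ.filter fun k : Fin 6 =>
        (pathDet (fun _ => (1 : ℝ)) d (fun _ => (1 : ℝ)) f k).eval x * (pathDet (fun _ => (1 : ℝ)) d (fun _ => (1 : ℝ)) f (k + 1)).eval x < 0).card
      = 2 := by
  obtain ⟨hD1, hD2, hD3, hD4, hD5, hD6⟩ := signs_above_one_seven d f x hx1 hslope hroot
  have hD0 : (pathDet (fun _ => (1 : ℝ)) d (fun _ => (1 : ℝ)) f 0).eval x = 1 := (eval_unit_zero_one d f x).1
  have h0 : ¬ (pathDet (fun _ => (1 : ℝ)) d (fun _ => (1 : ℝ)) f 0).eval x * (pathDet (fun _ => (1 : ℝ)) d (fun _ => (1 : ℝ)) f (0 + 1)).eval x < 0 := by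
    rw [hD0, one_mul]; exact not_lt.2 hD1.le
  have h1 : (pathDet (fun _ => (1 : ℝ)) d (fun _ => (1 : ℝ)) f 1).eval x * (pathDet (fun _ => (1 : ℝ)) d (fun _ => (1 : ℝ)) f (1 + 1)).eval x < 0 :=
    mul_neg_of_pos_of_neg hD1 hD2
  have h2 : ¬ (pathDet (fun _ => (1 : ℝ)) d (fun _ => (1 : ℝ)) f 2).eval x * (pathDet (fun _ => (1 : ℝ)) d (fun _ => (1 : ℝ)) f (2 + 1)).eval x < 0 :=
    not_lt.2 (mul_pos_of_neg_of_neg hD2 hD3).le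
  have h3 : ¬ (pathDet (fun _ => (1 : ℝ)) d (fun _ => (1 : ℝ)) f 3).eval x * (pathDet (fun _ => (1 : ℝ)) d (fun _ => (1 : ℝ)) f (3 + 1)).eval x < 0 :=
    not_lt.2 (mul_pos_of_neg_of_neg hD3 hD4).le
  have h4 : (pathDet (fun _ => (1 : ℝ)) d (fun _ => (1 : ℝ)) f 4).eval x * (pathDet (fun _ => (1 : ℝ)) d (fun _ => (1 : ℝ)) f (4 + 1)).eval x < 0 :=
    mul_neg_of_neg_of_pos hD4 hD5
  have h5 : ¬ (pathDet (fun _ => (1 : ℝ)) d (fun _ => (1 : ℝ)) f 5).eval x * (pathDet (fun _ => (1 : ℝ)) d (fun _ => (1 : ℝ)) f (5 + 1)).eval x < 0 :=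
    not_lt.2 (mul_pos hD5 hD6).le
  rw [sturmCount_eq_sum d f 6 x]
  simp only [Finset.sum_range_succ, Finset.sum_range_zero, if_neg h0, if_pos h1, if_neg h2, if_neg h3, if_pos h4, if_neg h5]

end StaticTridiagonalRealUnit
end Summit.ValiantsHypothesis.ValiantsHypothesis.Theorems.KPlusLogSqLaw
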